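import Literature.NumberTheory.Automorphic.BrandtSetupAdmissible
import Literature.NumberTheory.EllipticCurves.ZhangLevelRaisedKolyvaginData
import HarnessLib

/-!
# Line `admdef` v6, cell β ([NV″] in the definite currency): a Brandt set-up of type `(N, ∏ s)`
# EXISTS for every Zhang-admissible level `s` of odd cardinality (crux `AnticyclotomicEisensteinDivisibility`,
# stmt-BirchSwinnertonDyer-20727)

Lead seat bsd-line-sbc-p1 (gen 16), `--supports stmt-BirchSwinnertonDyer-20727`.  The v6 research stubs
`stub_definiteNV_twoMult` / `stub_definiteNV_leOneMult` of `Lines/admdef.lean` (and the bridge stub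
`stub_bipartiteBridge`) quantify `∃ (S : Brandt.XiSetup N (∏ q ∈ s, q)) …` over an odd Zhang-admissible
level `s` (a finite set of Bertolini–Darmon 1-admissible primes, `IsZhangAdmissibleLevel N K a p s`).  THIS
FILE discharges the set-up part of that existential once and for all, from the tree's characterisation
`Brandt.nonempty_xiSetup_iff_admissible` (Vignéras III §3 Thm 3.1 + Eichler orders, PROVED there):

* `squarefree_prod_of_isZhangAdmissibleLevel`, `odd_card_primeFactors_prod_of_isZhangAdmissibleLevel`,
  `coprime_prod_of_isZhangAdmissibleLevel` — `∏ s` is square-free, has `|s|` prime factors, and is prime to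
  `N` (an admissible prime does not divide `pN`);
* `nonempty_xiSetup_of_isZhangAdmissibleLevel` — **for `0 < N` and `s` Zhang-admissible of odd cardinality,
  `Nonempty (Brandt.XiSetup N (∏ q ∈ s, q))`**: the definite quaternion algebra over `ℚ` of discriminant
  `∏ s` with an Eichler order of level `N` exists.

All PROVED (standard axioms); no definition, no named fact, no `sorry`.  BSD / the crux / [NV″] are NOT
proved by this file.
-/

-- D-0017: single-problem summit, the namespace repeats the problem name by design.
set_option linter.dupNamespace false
set_option autoImplicit false

noncomputable section

open scoped Classical

open Literature.NumberTheory.EllipticCurves Literature.NumberTheory.Automorphic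

namespace Summit.BirchSwinnertonDyer.BirchSwinnertonDyer.Theorems.SignedBaseChangeAcDivAdmdefDefiniteSetup

variable {N : ℕ} {K : Type} [Field K] {a : ℕ → ℤ} {p : ℕ} {s : Finset ℕ}

/-- Every member of a Zhang-admissible level is prime. [cite: WZhang2014, Notations (xiv) (p. 202)] -/
theorem prime_of_mem_of_isZhangAdmissibleLevel (hs : IsZhangAdmissibleLevel N K a p s) {q : ℕ}
    (hq : q ∈ s) : q.Prime :=
  (hs q hq).prime

/-- The product of a Zhang-admissible level is square-free (distinct primes).
[cite: WZhang2014, Notations (xiv) (p. 202)] -/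
theorem squarefree_prod_of_isZhangAdmissibleLevel (hs : IsZhangAdmissibleLevel N K a p s) :
    Squarefree (∏ q ∈ s, q) := by
  refine Finset.squarefree_prod_of_pairwise_isCoprime ?_
    fun q hq ↦ (prime_of_mem_of_isZhangAdmissibleLevel hs hq).prime.squarefree
  intro q hq r hr hqr
  exact Nat.coprime_iff_isRelPrime.mp
    ((Nat.coprime_primes (prime_of_mem_of_isZhangAdmissibleLevel hs hq)
      (prime_of_mem_of_isZhangAdmissibleLevel hs hr)).mpr hqr)

/-- The set of prime factors of `∏ s` is `s`; in particular it has odd cardinality when `s` has.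
[cite: WZhang2014, Notations (xiv) (p. 202)] -/
theorem odd_card_primeFactors_prod_of_isZhangAdmissibleLevel (hs : IsZhangAdmissibleLevel N K a p s)
    (hodd : Odd s.card) : Odd (∏ q ∈ s, q).primeFactors.card := by
  rwa [Nat.primeFactors_prod fun q hq ↦ prime_of_mem_of_isZhangAdmissibleLevel hs hq]

/-- `∏ s` is prime to `N`: an admissible prime `q` satisfies `q ∤ pN`, hence `q ∤ N`.
[cite: BertoliniDarmon2005, p. 18 (Admissible primes) (1)] -/
theorem coprime_prod_of_isZhangAdmissibleLevel (hs : IsZhangAdmissibleLevel N K a p s) :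
    Nat.Coprime N (∏ q ∈ s, q) := by
  refine Nat.Coprime.prod_right fun q hq ↦ ?_
  have hq := hs q hq
  refine (Nat.coprime_comm.mp ((Nat.Prime.coprime_iff_not_dvd hq.prime).mpr ?_))
  exact fun h ↦ hq.not_dvd (dvd_mul_of_dvd_right h p)

/-- **A Brandt set-up of type `(N, ∏ s)` exists** for `0 < N` and every Zhang-admissible level `s` of ODD
cardinality: the definite quaternion algebra over `ℚ` ramified exactly at the primes of `s` (and `∞`), with
an Eichler order of level `N` — by the tree's `Brandt.nonempty_xiSetup_iff_admissible`.  Discharges the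
`∃ S : Brandt.XiSetup N (∏ q ∈ s, q)` of the v6 stubs `stub_definiteNV_*` / `stub_bipartiteBridge`.
[cite: VignerasLNM800, Ch. III §3 Thm. 3.1 and Ch. III §5] [cite: WZhang2014, §3.3 (the Shimura set X_{N⁺, N⁻m})] -/
theorem nonempty_xiSetup_of_isZhangAdmissibleLevel (hN : 0 < N) (hs : IsZhangAdmissibleLevel N K a p s)
    (hodd : Odd s.card) : Nonempty (Brandt.XiSetup N (∏ q ∈ s, q)) :=
  Brandt.nonempty_xiSetup_iff_admissible.mpr
    ⟨hN, squarefree_prod_of_isZhangAdmissibleLevel hs, odd_card_primeFactors_prod_of_isZhangAdmissibleLevel hs hodd,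
      coprime_prod_of_isZhangAdmissibleLevel hs⟩

end Summit.BirchSwinnertonDyer.BirchSwinnertonDyer.Theorems.SignedBaseChangeAcDivAdmdefDefiniteSetup

end
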